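import Summits.CriticalPhenomena.SAWScalingLimit.Theorems.SAWLoopFugacityFlowIsingBoundaryRatioWindowRectSucc
import Summits.CriticalPhenomena.SAWScalingLimit.Theorems.SAWLoopFugacityFlowIsingBoundaryRatioWindowRectGeomDefs
import HarnessLib

/-!
# The offset boundary polygon: its range (sides of buds and connectors)
(line `fk-anchor-transfer`, crux `IsingBoundaryRatio`, stmt-CriticalPhenomena-10650; helper file of the stub
`windowRectPresentation_holds`)

For the offset boundary polygon `arcPath E δ η d m` of `…WindowRectGeomDefs.lean` we prove that every point
of it lies either on the SIDE of one of the darts `succ^[i] d`, `i ≤ m` — the segment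
`[framePt δ dᵢ η (-η), framePt δ dᵢ η η]` — or on a CONNECTOR alongside an edge of `E`: a point
`framePt δ a t (±η)` with `aedge a ∈ E` and `η ≤ t ≤ δ - η` (`range_arcPath_subset`). This is pure
bookkeeping of the four branches of `DiscreteRect.succ` (`succ_spec`) and of the affine algebra of frame
points. [folklore]
-/

noncomputable section

open scoped Classical
open Set Literature.Probability.LatticeModels Literature.Probability.LatticeModels.DiscreteRect

namespace Summit.CriticalPhenomena.SAWScalingLimit.Theorems.IsingBoundaryRatio

namespace WindowRect

/-! ### Affine algebra of mesh points and frame points -/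

/-- `meshPoint` of a lattice step: `δ(x + e_k) = δx + δe_k`. [folklore] -/
theorem meshPoint_add_dir (δ : ℝ) (x : Site 2) (k : Fin 4) :
    meshPoint δ (x + dir k) = meshPoint δ x + meshPoint δ (dir k) := by
  apply Complex.ext <;> simp [meshPoint, Site.toComplex] <;> ring

/-- `meshPoint` is additive in the scale. [folklore] -/
theorem meshPoint_add_scale (s t : ℝ) (x : Site 2) : meshPoint (s + t) x = meshPoint s x + meshPoint t x := by
  apply Complex.ext <;> simp [meshPoint] <;> ring

/-- `meshPoint` is homogeneous in the scale. [folklore] -/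
theorem meshPoint_mul_scale (c t : ℝ) (x : Site 2) : meshPoint (c * t) x = (c : ℂ) * meshPoint t x := by
  apply Complex.ext <;> simp [meshPoint] <;> ring

/-- Opposite directions at scale `t`. [folklore] -/
theorem meshPoint_dir_add_two (t : ℝ) (k : Fin 4) : meshPoint t (dir (k + 2)) = -meshPoint t (dir k) := by
  rw [dir_add_two]
  apply Complex.ext <;> simp [meshPoint, Site.toComplex]

/-- Opposite directions at scale `t`, shifted. [folklore] -/
theorem meshPoint_dir_add_three (t : ℝ) (k : Fin 4) : meshPoint t (dir (k + 3)) = -meshPoint t (dir (k + 1)) := by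
  rw [← fin4_add_one_add_two, meshPoint_dir_add_two]

/-- Negative scale. [folklore] -/
theorem meshPoint_neg_scale (t : ℝ) (x : Site 2) : meshPoint (-t) x = -meshPoint t x := by
  apply Complex.ext <;> simp [meshPoint]

/-- Frame points are affine in the first coordinate. [folklore] -/
theorem framePt_lineMap_fst (δ : ℝ) (a : Site 2 × Fin 4) (t₀ t₁ s θ : ℝ) :
    AffineMap.lineMap (framePt δ a t₀ s) (framePt δ a t₁ s) θ = framePt δ a ((1 - θ) * t₀ + θ * t₁) s := by
  rw [AffineMap.lineMap_apply_module]
  simp only [framePt]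
  apply Complex.ext <;> simp [meshPoint] <;> ring

/-- Frame points are affine in the second coordinate. [folklore] -/
theorem framePt_lineMap_snd (δ : ℝ) (a : Site 2 × Fin 4) (t s₀ s₁ θ : ℝ) :
    AffineMap.lineMap (framePt δ a t s₀) (framePt δ a t s₁) θ = framePt δ a t ((1 - θ) * s₀ + θ * s₁) := by
  rw [AffineMap.lineMap_apply_module]
  simp only [framePt]
  apply Complex.ext <;> simp [meshPoint] <;> ring

/-- A point of a segment between two frame points with the same second coordinate is a frame point with
first coordinate in between. [folklore] -/
theorem exists_of_mem_segment_fst {δ : ℝ} {a : Site 2 × Fin 4} {t₀ t₁ s : ℝ} (h01 : t₀ ≤ t₁) {z : ℂ}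
    (hz : z ∈ segment ℝ (framePt δ a t₀ s) (framePt δ a t₁ s)) : ∃ t ∈ Icc t₀ t₁, z = framePt δ a t s := by
  rw [segment_eq_image_lineMap] at hz
  obtain ⟨θ, ⟨h0, h1⟩, rfl⟩ := hz
  refine ⟨(1 - θ) * t₀ + θ * t₁, ⟨?_, ?_⟩, framePt_lineMap_fst δ a t₀ t₁ s θ⟩ <;> nlinarith

/-- The same for the second coordinate. [folklore] -/
theorem exists_of_mem_segment_snd {δ : ℝ} {a : Site 2 × Fin 4} {t s₀ s₁ : ℝ} (h01 : s₀ ≤ s₁) {z : ℂ}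
    (hz : z ∈ segment ℝ (framePt δ a t s₀) (framePt δ a t s₁)) : ∃ s ∈ Icc s₀ s₁, z = framePt δ a t s := by
  rw [segment_eq_image_lineMap] at hz
  obtain ⟨θ, ⟨h0, h1⟩, rfl⟩ := hz
  refine ⟨(1 - θ) * s₀ + θ * s₁, ⟨?_, ?_⟩, framePt_lineMap_snd δ a t s₀ s₁ θ⟩ <;> nlinarith

/-- A frame point with second coordinate in `[s₀, s₁]` lies on the corresponding segment. [folklore] -/
theorem framePt_mem_segment_snd (δ : ℝ) (a : Site 2 × Fin 4) (t : ℝ) {s₀ s₁ s : ℝ} (h0 : s₀ ≤ s) (h1 : s ≤ s₁)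
    (h01 : s₀ < s₁) : framePt δ a t s ∈ segment ℝ (framePt δ a t s₀) (framePt δ a t s₁) := by
  rw [segment_eq_image_lineMap]
  refine ⟨(s - s₀) / (s₁ - s₀), ⟨div_nonneg (by linarith) (by linarith), (div_le_one (by linarith)).2 (by linarith)⟩,
    ?_⟩
  rw [framePt_lineMap_snd]
  congr 1
  have h : s₁ - s₀ ≠ 0 := by linarith
  field_simp
  ring

/-! ### Frame identities around one step of the trace -/

variable (δ η : ℝ)

/-- End of the side of `(x, k)` = start of the side of `(x, k+1)`. [folklore] -/
theorem framePt_turn (x : Site 2) (k : Fin 4) : framePt δ (x, k) η η = framePt δ (x, k + 1) η (-η) := by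
  simp only [framePt, fin4_add_one_add_one, meshPoint_dir_add_two, meshPoint_neg_scale]
  abel

/-- End of the side of `(x, k)` in the frame of the arrow `(x, k+1)`. [folklore] -/
theorem framePt_end_eq (x : Site 2) (k : Fin 4) : framePt δ (x, k) η η = framePt δ (x, k + 1) η (-η) :=
  framePt_turn δ η x k

/-- Start of the side of `(x + e_{k+1}, k)` in the frame of the arrow `(x, k+1)`. [folklore] -/
theorem framePt_start_shift (x : Site 2) (k : Fin 4) :
    framePt δ (x + dir (k + 1), k) η (-η) = framePt δ (x, k + 1) (δ - η) (-η) := by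
  simp only [framePt, fin4_add_one_add_one, meshPoint_dir_add_two, meshPoint_neg_scale, meshPoint_add_dir,
    sub_eq_add_neg, meshPoint_add_scale]
  abel

/-- The far corner of the square about `δ(y + e_k)` in the frame of `(y, k)`. [folklore] -/
theorem framePt_corner_shift (y : Site 2) (k : Fin 4) :
    framePt δ (y + dir k, k) (-η) (-η) = framePt δ (y, k) (δ - η) (-η) := by
  simp only [framePt, meshPoint_neg_scale, meshPoint_add_dir, sub_eq_add_neg, meshPoint_add_scale]
  abel

/-- Start of the side of `(y + e_k, k+3)` in the frame of `(y, k)`. [folklore] -/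
theorem framePt_start_shift' (y : Site 2) (k : Fin 4) :
    framePt δ (y + dir k, k + 3) η (-η) = framePt δ (y, k) (δ - η) (-η) := by
  simp only [framePt, fin4_add_three_add_one, meshPoint_dir_add_three, meshPoint_neg_scale, meshPoint_add_dir,
    sub_eq_add_neg, meshPoint_add_scale]
  abel

/-- The far corner of the square about `δ(x + e_{k+1} + e_k)` in the frame of `(x + e_k, k+1)`. [folklore] -/
theorem framePt_corner_shift' (x : Site 2) (k : Fin 4) :
    framePt δ (x + dir (k + 1) + dir k, k) (-η) (-η) = framePt δ (x + dir k, k + 1) (δ - η) η := by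
  simp only [framePt, fin4_add_one_add_one, meshPoint_dir_add_two, meshPoint_neg_scale, meshPoint_add_dir,
    sub_eq_add_neg, meshPoint_add_scale]
  abel

/-- The far corner, from the frame of `(x + e_{k+1}, k)` to the frame of `(x + e_k, k+1)`. [folklore] -/
theorem framePt_corner_reframe (x : Site 2) (k : Fin 4) :
    framePt δ (x + dir (k + 1), k) (δ - η) (-η) = framePt δ (x + dir k, k + 1) (δ - η) η := by
  rw [← framePt_corner_shift, framePt_corner_shift']

/-- Start of the side of `(x + e_k, k+2)` in the frame of `(x + e_k, k+1)`. [folklore] -/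
theorem framePt_start_shift'' (x : Site 2) (k : Fin 4) :
    framePt δ (x + dir k, k + 2) η (-η) = framePt δ (x + dir k, k + 1) η η := by
  simp only [framePt, fin4_add_one_add_one, fin4_add_two_add_one, meshPoint_dir_add_two, meshPoint_dir_add_three,
    meshPoint_neg_scale]
  abel

/-! ### The range of the polygon: sides and connectors -/

variable {δ η} {E : Finset (Sym2 (Site 2))}

/-- The second half of a side lies on the side. [folklore] -/
theorem segment_bud_end_subset (hη : 0 < η) (d : Site 2 × Fin 4) :
    segment ℝ (framePt δ d η 0) (framePt δ d η η) ⊆ segment ℝ (framePt δ d η (-η)) (framePt δ d η η) := by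
  intro z hz
  obtain ⟨s, ⟨hs0, hs1⟩, rfl⟩ := exists_of_mem_segment_snd hη.le hz
  exact framePt_mem_segment_snd δ d η (by linarith) hs1 (by linarith)

/-- The first half of a side lies on the side. [folklore] -/
theorem segment_start_bud_subset (hη : 0 < η) (d : Site 2 × Fin 4) :
    segment ℝ (framePt δ d η (-η)) (framePt δ d η 0) ⊆ segment ℝ (framePt δ d η (-η)) (framePt δ d η η) := by
  intro z hz
  obtain ⟨s, ⟨hs0, hs1⟩, rfl⟩ := exists_of_mem_segment_snd (by linarith) hz
  exact framePt_mem_segment_snd δ d η hs0 (by linarith) (by linarith)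

/-- **The connector runs along sides of buds or alongside edges of `E`.** Every point of `linkPath E δ η d`
is the end of the side of `d`, or a point `framePt δ a t (±η)` with `aedge a ∈ E`, `η ≤ t ≤ δ - η`.
[folklore] -/
theorem range_linkPath_subset (h2 : 2 * η ≤ δ) (d : Site 2 × Fin 4) {z : ℂ} (hz : z ∈ range (linkPath E δ η d)) :
    z = framePt δ d η η ∨
      ∃ a : Site 2 × Fin 4, aedge a ∈ E ∧ ∃ t ∈ Icc η (δ - η), (z = framePt δ a t η ∨ z = framePt δ a t (-η)) := by
  obtain ⟨x, k⟩ := d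
  have hηδ : η ≤ δ - η := by linarith
  -- the three possible connector pieces
  have piece1 : ∀ {w : ℂ}, s(x, x + dir (k + 1)) ∈ E →
      w ∈ segment ℝ (framePt δ (x, k) η η) (framePt δ (x + dir (k + 1), k) η (-η)) →
      ∃ a : Site 2 × Fin 4, aedge a ∈ E ∧ ∃ t ∈ Icc η (δ - η), (w = framePt δ a t η ∨ w = framePt δ a t (-η)) := by
    intro w h1 hw
    rw [framePt_end_eq, framePt_start_shift] at hw
    obtain ⟨t, ht, rfl⟩ := exists_of_mem_segment_fst hηδ hw
    exact ⟨(x, k + 1), h1, t, ht, Or.inr rfl⟩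
  have piece2 : ∀ {w : ℂ}, s(x + dir (k + 1), x + dir (k + 1) + dir k) ∈ E →
      w ∈ segment ℝ (framePt δ (x + dir (k + 1), k) η (-η)) (framePt δ (x + dir (k + 1), k) (δ - η) (-η)) →
      ∃ a : Site 2 × Fin 4, aedge a ∈ E ∧ ∃ t ∈ Icc η (δ - η), (w = framePt δ a t η ∨ w = framePt δ a t (-η)) := by
    intro w h2 hw
    obtain ⟨t, ht, rfl⟩ := exists_of_mem_segment_fst hηδ hw
    exact ⟨(x + dir (k + 1), k), h2, t, ht, Or.inr rfl⟩
  have piece3 : ∀ {w : ℂ}, s(x + dir (k + 1) + dir k, x + dir k) ∈ E →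
      w ∈ segment ℝ (framePt δ (x + dir k, k + 1) (δ - η) η) (framePt δ (x + dir k, k + 1) η η) →
      ∃ a : Site 2 × Fin 4, aedge a ∈ E ∧ ∃ t ∈ Icc η (δ - η), (w = framePt δ a t η ∨ w = framePt δ a t (-η)) := by
    intro w h3 hw
    rw [segment_symm] at hw
    obtain ⟨t, ht, rfl⟩ := exists_of_mem_segment_fst hηδ hw
    refine ⟨(x + dir k, k + 1), ?_, t, ht, Or.inl rfl⟩
    show s(x + dir k, x + dir k + dir (k + 1)) ∈ E
    rw [Sym2.eq_swap, show x + dir k + dir (k + 1) = x + dir (k + 1) + dir k by abel]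
    exact h3
  simp only [linkPath] at hz
  rcases succ_spec E x k with ⟨h1, he⟩ | ⟨h1, h2, he⟩ | ⟨h1, h2, h3, he⟩ | ⟨h1, h2, h3, he⟩
  · rw [if_pos h1, Path.range_segment, he, ← framePt_turn, segment_same] at hz
    exact Or.inl hz
  · rw [if_neg (not_not.2 h1), if_pos h2, Path.range_segment, he] at hz
    exact Or.inr (piece1 h1 hz)
  · rw [if_neg (not_not.2 h1), if_neg (not_not.2 h2), if_pos h3, Path.trans_range, Path.range_segment,
      Path.range_segment, he, framePt_start_shift'] at hz
    rcases hz with hz | hz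
    · exact Or.inr (piece1 h1 hz)
    · exact Or.inr (piece2 h2 hz)
  · rw [if_neg (not_not.2 h1), if_neg (not_not.2 h2), if_neg (not_not.2 h3), Path.trans_range, Path.trans_range,
      Path.range_segment, Path.range_segment, Path.range_segment, he, framePt_corner_shift,
      framePt_start_shift''] at hz
    rcases hz with hz | hz | hz
    · exact Or.inr (piece1 h1 hz)
    · exact Or.inr (piece2 h2 hz)
    · rw [framePt_corner_reframe] at hz
      exact Or.inr (piece3 h3 hz)

/-- Range of the polygon with no step. [folklore] -/
theorem range_arcPath_zero (d : Site 2 × Fin 4) : range (arcPath E δ η d 0) = {framePt δ d η 0} :=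
  Path.refl_range

/-- Range of the polygon with one more step. [folklore] -/
theorem range_arcPath_succ (d : Site 2 × Fin 4) (m : ℕ) :
    range (arcPath E δ η d (m + 1)) = range (stepPath E δ η d) ∪ range (arcPath E δ η (succ E d) m) :=
  Path.trans_range _ _

/-- **One step of the polygon runs along the sides of its two darts or alongside edges of `E`.**
[folklore] -/
theorem range_stepPath_subset (hη : 0 < η) (h2 : 2 * η ≤ δ) (d : Site 2 × Fin 4) {z : ℂ}
    (hz : z ∈ range (stepPath E δ η d)) :
    z ∈ segment ℝ (framePt δ d η (-η)) (framePt δ d η η) ∨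
      z ∈ segment ℝ (framePt δ (succ E d) η (-η)) (framePt δ (succ E d) η η) ∨
      ∃ a : Site 2 × Fin 4, aedge a ∈ E ∧ ∃ t ∈ Icc η (δ - η), (z = framePt δ a t η ∨ z = framePt δ a t (-η)) := by
  simp only [stepPath, Path.trans_range, Path.range_segment, mem_union] at hz
  rcases hz with hz | hz | hz
  · exact Or.inl (segment_bud_end_subset hη d hz)
  · rcases range_linkPath_subset h2 d hz with rfl | h
    · exact Or.inl (right_mem_segment _ _ _)
    · exact Or.inr (Or.inr h)
  · exact Or.inr (Or.inl (segment_start_bud_subset hη _ hz))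

/-- **The offset boundary polygon runs along the sides of its darts or alongside edges of `E`.** Every
point of `arcPath E δ η d m` lies on the side `[framePt δ dᵢ η (-η), framePt δ dᵢ η η]` of some
`dᵢ = succ^[i] d`, `i ≤ m`, or is a connector point `framePt δ a t (±η)`, `aedge a ∈ E`, `η ≤ t ≤ δ - η`.
[folklore] -/
theorem range_arcPath_subset (hη : 0 < η) (h2 : 2 * η ≤ δ) (d : Site 2 × Fin 4) (m : ℕ) {z : ℂ}
    (hz : z ∈ range (arcPath E δ η d m)) :
    (∃ i ≤ m, z ∈ segment ℝ (framePt δ ((succ E)^[i] d) η (-η)) (framePt δ ((succ E)^[i] d) η η)) ∨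
      ∃ a : Site 2 × Fin 4, aedge a ∈ E ∧ ∃ t ∈ Icc η (δ - η), (z = framePt δ a t η ∨ z = framePt δ a t (-η)) := by
  induction m generalizing d with
  | zero =>
    rw [range_arcPath_zero, mem_singleton_iff] at hz
    subst hz
    refine Or.inl ⟨0, le_rfl, ?_⟩
    exact framePt_mem_segment_snd δ d η (by linarith) hη.le (by linarith)
  | succ m ih =>
    rw [range_arcPath_succ, mem_union] at hz
    rcases hz with hz | hz
    · rcases range_stepPath_subset hη h2 d hz with h | h | h
      · exact Or.inl ⟨0, Nat.zero_le _, h⟩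
      · exact Or.inl ⟨1, by omega, h⟩
      · exact Or.inr h
    · rcases ih (succ E d) hz with ⟨i, hi, h⟩ | h
      · refine Or.inl ⟨i + 1, by omega, ?_⟩
        rwa [Function.iterate_succ_apply]
      · exact Or.inr h

end WindowRect

/-- **The offset boundary polygon runs along the sides of its darts or alongside edges of `E`**, closed
form (registered sub-goal of stmt-CriticalPhenomena-10650). [folklore] -/
theorem windowRect_range_arcPath_subset : ∀ {δ η : ℝ} {E : Finset (Sym2 (Site 2))}, 0 < η → 2 * η ≤ δ → ∀ (d : Site 2 × Fin 4) (m : ℕ) {z : ℂ}, z ∈ Set.range (WindowRect.arcPath E δ η d m) → (∃ i ≤ m, z ∈ segment ℝ (WindowRect.framePt δ ((DiscreteRect.succ E)^[i] d) η (-η)) (WindowRect.framePt δ ((DiscreteRect.succ E)^[i] d) η η)) ∨ ∃ a : Site 2 × Fin 4, DiscreteRect.aedge a ∈ E ∧ ∃ t ∈ Set.Icc η (δ - η), (z = WindowRect.framePt δ a t η ∨ z = WindowRect.framePt δ a t (-η)) :=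
  fun hη h2 d m _ hz => WindowRect.range_arcPath_subset hη h2 d m hz

end Summit.CriticalPhenomena.SAWScalingLimit.Theorems.IsingBoundaryRatio

end
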